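import Summits.KontsevichZagierPeriods.KontsevichZagierPeriods.Theorems.LinRedNormalFormArrangementNormalFormStubRebaseSimpleZeroManyChainRoom

/-!
# Stub `stub_rebaseSimpleZeroMany`, part `rebaseSimpleZeroMany_common` (crux `ArrangementNormalForm`,
line `janus-bands`) — brick `ChainRoomFinal`

**The chain theorems with the exceptional set WITH ROOM** (`RebaseChain.mixedSetR n`, brick
`ChainRoom`): the dissection of the base interval (`IsChain.goodR`), the clean chain with letters
of a common `y`-slope (`RebaseChain.goodR_cleanChain`) and the chain in an arbitrary order of the
fibre indices (`RebaseChain.goodR_permChain`) are congruent modulo `KZ.relations` to the subgroup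
generated by `GG 0 2 (n + 1)` and `mixedSetR n`, UNCONDITIONALLY. This is the sharpest form of
the common-slope chain part of `stub_rebaseSimpleZeroMany`: the exceptional members are pinched
chains over an explicit two-row cell with the base pole at the pinch abscissa, a vertex letter,
(a free fibre and an off-vertex letter, or two off-vertex letters), and recorded room `η, T` of
the off-vertex letters. Registered: `rebaseSimpleZeroMany_permChainRoom`.

References: M. Kontsevich, D. Zagier, *Periods* (2001), §1.2, rules (1a), (2).
-/

noncomputable section

open Set MeasureTheory MvPolynomial
open Literature.NumberTheory.Transcendental Literature.ModelTheory.ExponentialFields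

namespace Summit.KontsevichZagierPeriods.ArrangementNormalForm.JanusBands

namespace RebaseChain

open SeparatePos RebasePos RebaseZero RebaseNest

variable {n : ℕ} {A Bd : Cf} {T : BData} {a : Fin (n + 1) → Option Cf}

variable {m' : ℕ} {M : Fin m' → Cf} {s : KZ.IntegralRep (0 + 1 + (n + 1))} {p : MvPolynomial (Fin 0) ℚ} in
/-- **Cutting the base cell at a rational form** (rule 1a), `GoodR` version of
`IsChain.rowSplit`. -/
theorem IsChain.rowSplitR (h : IsChain s M A Bd T p a) (q : Cf) (hq : q ≠ 0)
    (h₁ : ∀ s₁ : KZ.IntegralRep (0 + 1 + (n + 1)),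
      IsChain s₁ (Fin.snoc M q : Fin (m' + 1) → Cf) A Bd T p a → GoodR n (KZ.of s₁))
    (h₂ : ∀ s₂ : KZ.IntegralRep (0 + 1 + (n + 1)),
      IsChain s₂ (Fin.snoc M (-q) : Fin (m' + 1) → Cf) A Bd T p a → GoodR n (KZ.of s₂)) :
    GoodR n (KZ.of s) := by
  obtain ⟨s₁, s₂, hm₁, hm₂, hi₁, hi₂, hd₁, hd₂, hrel⟩ := cutBase s M (clo A) (chi Bd) h.dom q hq
  have hs₁ : s₁.domain ⊆ s.domain := fun z hz => ((hm₁ z).1 hz).1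
  have hs₂ : s₂.domain ⊆ s.domain := fun z hz => ((hm₂ z).1 hz).1
  refine goodR_of_rel3 hrel (h₁ s₁ ⟨hd₁, fun z hz => ?_, h.n1, h.n2, h.a0, h.bdd.subset hs₁⟩)
    (h₂ s₂ ⟨hd₂, fun z hz => ?_, h.n1, h.n2, h.a0, h.bdd.subset hs₂⟩)
  · rw [hi₁]; exact h.int (hs₁ hz)
  · rw [hi₂]; exact h.int (hs₂ hz)


variable {m' : ℕ} {s : KZ.IntegralRep (0 + 1 + (n + 1))} {M : Fin m' → Cf} {p : MvPolynomial (Fin 0) ℚ}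

/-- **The dissection of the base interval.** A clean chain of `n + 1` fibres over a
one-dimensional base with constant letters and a simple base pole is good for the enlarged
target `GG 0 2 (n + 1) ∪ mixedSetR n` (resisting configurations with room). [Kontsevich–Zagier 2001, §1.2, rules (1), (2)] -/
theorem IsChain.goodR (hN : IsChain s M A Bd T p a) : GoodR n (KZ.of s) := by
  by_cases hαβ : A.1 (Fin.last 0) = Bd.1 (Fin.last 0)
  · -- parallel bounds
    have hD : ∀ y : ℝ, ev Bd y - ev A y = ((Bd.2 - A.2 : ℚ) : ℝ) := fun y => by
      have : (A.1 (Fin.last 0) : ℝ) = Bd.1 (Fin.last 0) := by exact_mod_cast hαβ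
      simp only [ev, Rat.cast_sub, this]
      ring
    by_cases hd : Bd.2 - A.2 ≤ 0
    · refine goodR_of_good (hN.good_empty fun y _ => ?_)
      have h0 : ((Bd.2 - A.2 : ℚ) : ℝ) ≤ 0 := by exact_mod_cast hd
      linarith [hD y]
    · exact goodR_of_good (hN.good_thick (Bd.2 - A.2) (not_le.1 hd) fun y _ => (hD y).ge)
  -- the pinch point
  have hne : Bd.1 (Fin.last 0) - A.1 (Fin.last 0) ≠ 0 := sub_ne_zero.2 (Ne.symm hαβ)
  set y₀ : ℚ := (A.2 - Bd.2) / (Bd.1 (Fin.last 0) - A.1 (Fin.last 0)) with hy₀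
  set t₀ : ℚ := A.1 (Fin.last 0) * y₀ + A.2 with ht₀
  have hA0 : A.1 (Fin.last 0) * y₀ + A.2 = t₀ := rfl
  have hB0 : Bd.1 (Fin.last 0) * y₀ + Bd.2 = t₀ := by
    have : (Bd.1 (Fin.last 0) - A.1 (Fin.last 0)) * y₀ = A.2 - Bd.2 := by
      rw [hy₀]; field_simp
    rw [ht₀]; linarith
  have hD : ∀ y : ℝ, ev Bd y - ev A y = ((Bd.1 (Fin.last 0) : ℝ) - A.1 (Fin.last 0)) * (y - y₀) :=
    ev_sub_vertex hA0 hB0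
  -- the explicit caps on both sides
  obtain ⟨εR, hεR, hgoodR⟩ := pinch_sideR (ε₁ := 1) T a (Or.inl rfl) hA0 hB0 M (RebaseZero.mk 1 (-y₀))
    fun y => by rw [ev_mk]; push_cast; ring
  obtain ⟨εL, hεL, hgoodL⟩ := pinch_sideR (ε₁ := -1) T a (Or.inr rfl) hA0 hB0 M (-RebaseZero.mk 1 (-y₀))
    fun y => by rw [ev_neg, ev_mk]; push_cast; ring
  have hεR' : (0 : ℝ) < εR := by exact_mod_cast hεR
  have hεL' : (0 : ℝ) < εL := by exact_mod_cast hεL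
  refine hN.rowSplitR (RebaseZero.mk 1 (-y₀)) (mk_ne_zero one_ne_zero _) (fun s₁ h₁ => ?_) (fun s₂ h₂ => ?_)
  · -- the right side `y > y₀`
    refine h₁.rowSplitR (RebaseZero.mk (-1) (1 * y₀ + εR)) (mk_ne_zero (by norm_num) _)
      (fun s₃ h₃ => hgoodR s₃ p h₃) fun s₄ h₄ => ?_
    -- the far piece `y > y₀ + εR`
    have hfar : ∀ y ∈ cell (Fin.snoc (Fin.snoc M (RebaseZero.mk 1 (-y₀)) : Fin (m' + 1) → Cf)
        (-RebaseZero.mk (-1) (1 * y₀ + εR)) : Fin (m' + 2) → Cf), (εR : ℝ) < y - y₀ := fun y hy => by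
      rw [mem_cell_snoc_snoc] at hy
      obtain ⟨-, -, h2⟩ := hy
      rw [ev_neg, ev_mk] at h2
      push_cast at h2
      linarith
    rcases lt_or_gt_of_ne hαβ with hlt | hgt
    · refine goodR_of_good (h₄.good_thick ((Bd.1 (Fin.last 0) - A.1 (Fin.last 0)) * εR)
        (mul_pos (sub_pos.2 hlt) hεR) fun y hy => ?_)
      have hlt' : (A.1 (Fin.last 0) : ℝ) < Bd.1 (Fin.last 0) := by exact_mod_cast hlt
      rw [hD y, Rat.cast_mul, Rat.cast_sub]
      nlinarith [hfar y hy]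
    · refine goodR_of_good (h₄.good_empty fun y hy => ?_)
      have hgt' : (Bd.1 (Fin.last 0) : ℝ) < A.1 (Fin.last 0) := by exact_mod_cast hgt
      nlinarith [hfar y hy, hD y, hεR']
  · -- the left side `y < y₀`
    refine h₂.rowSplitR (RebaseZero.mk (-(-1)) (-1 * y₀ + εL)) (mk_ne_zero (by norm_num) _)
      (fun s₃ h₃ => hgoodL s₃ p h₃) fun s₄ h₄ => ?_
    -- the far piece `y < y₀ - εL`
    have hfar : ∀ y ∈ cell (Fin.snoc (Fin.snoc M (-RebaseZero.mk 1 (-y₀)) : Fin (m' + 1) → Cf)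
        (-RebaseZero.mk (-(-1)) (-1 * y₀ + εL)) : Fin (m' + 2) → Cf), (εL : ℝ) < y₀ - y := fun y hy => by
      rw [mem_cell_snoc_snoc] at hy
      obtain ⟨-, -, h2⟩ := hy
      rw [ev_neg, ev_mk] at h2
      push_cast at h2
      linarith
    rcases lt_or_gt_of_ne hαβ with hlt | hgt
    · refine goodR_of_good (h₄.good_empty fun y hy => ?_)
      have hlt' : (A.1 (Fin.last 0) : ℝ) < Bd.1 (Fin.last 0) := by exact_mod_cast hlt
      nlinarith [hfar y hy, hD y, hεL']
    · refine goodR_of_good (h₄.good_thick ((A.1 (Fin.last 0) - Bd.1 (Fin.last 0)) * εL)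
        (mul_pos (sub_pos.2 hgt) hεL) fun y hy => ?_)
      have hgt' : (Bd.1 (Fin.last 0) : ℝ) < A.1 (Fin.last 0) := by exact_mod_cast hgt
      rw [hD y, Rat.cast_mul, Rat.cast_sub]
      nlinarith [hfar y hy]

/-- **Clean chains with letters of a common `y`-slope are good modulo the resisting configurations with room.**
A representation with a literal `GS 0 (n + 1)` datum (simple base pole: `n₁ = 0`, `n₂ = 1`) whose
fibres form the clean chain `A < t₀ < ⋯ < tₙ < B` and whose letters have the common `y`-slope
`λ` is good for `GG 0 2 (n + 1) ∪ mixedSetR n`: joint shear along `λ` (`RebaseChain.shear`), then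
the dissection of the base interval (`IsChain.goodR`). [Kontsevich–Zagier 2001, §1.2, rules (1), (2)] -/
theorem goodR_cleanChain {m n₁ n₂ : ℕ} (s : KZ.IntegralRep (0 + 1 + (n + 1)))
    (M : Fin m' → Cf) (L : Fin m → (Fin 0 → ℚ) × ℚ) (e : Fin m → ℕ) (p : MvPolynomial (Fin 0) ℚ)
    (ℓ₁ ℓ₂ : (Fin 0 → ℚ) × ℚ) (a : Fin (n + 1) → Option Cf) (A Bd : Cf) (h1 : n₁ = 0) (hn : n₂ = 1)
    (hbd : Bornology.IsBounded s.domain) (hdom : s.domain = gDom 0 (n + 1) m' M (clo A) (chi Bd))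
    (hint : EqOn s.integrand (glit 0 (n + 1) p L e ℓ₁ ℓ₂ n₁ n₂ a) s.domain)
    (lam : ℚ) (ha : ∀ l c, a l = some c → c.1 (Fin.last 0) = lam) : GoodR n (KZ.of s) := by
  obtain ⟨s', hN, hrel⟩ := shear s M L e p ℓ₁ ℓ₂ a A Bd h1 hn hbd hdom hint lam ha
  exact goodR_of_sub_mem hrel hN.goodR

variable (σ : Equiv.Perm (Fin (n + 1))) in
/-- **Chains in an arbitrary order of the fibre indices are good modulo the resisting
configurations with room.** A representation with a literal `GS 0 (n + 1)` datum (simple base pole) whose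
fibres form the chain `A < t_{σ⁻¹ 0} < ⋯ < t_{σ⁻¹ n} < B` and whose letters have the common
`y`-slope `λ` is good for `GG 0 2 (n + 1) ∪ mixedSetR n`: permute the coordinates (rule 2),
then `goodR_cleanChain`. [Kontsevich–Zagier 2001, §1.2, rules (1), (2)] -/
theorem goodR_permChain {m m' n₁ n₂ : ℕ} (s : KZ.IntegralRep (0 + 1 + (n + 1)))
    (M : Fin m' → Cf) (L : Fin m → (Fin 0 → ℚ) × ℚ) (e : Fin m → ℕ) (p : MvPolynomial (Fin 0) ℚ)
    (ℓ₁ ℓ₂ : (Fin 0 → ℚ) × ℚ) (a : Fin (n + 1) → Option Cf) (A Bd : Cf) (h1 : n₁ = 0) (hn : n₂ = 1)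
    (hbd : Bornology.IsBounded s.domain) (hdom : s.domain = gDom 0 (n + 1) m' M (plo σ A) (phi σ Bd))
    (hint : EqOn s.integrand (glit 0 (n + 1) p L e ℓ₁ ℓ₂ n₁ n₂ a) s.domain)
    (lam : ℚ) (ha : ∀ l c, a l = some c → c.1 (Fin.last 0) = lam) : GoodR n (KZ.of s) := by
  set s' := s.reindex (permIdx σ) with hs'
  have hmem : ∀ w, w ∈ s'.domain ↔ (fun i => w (permIdx σ i)) ∈ s.domain := fun w => by
    rw [hs', KZ.IntegralRep.reindex_domain]; rfl
  have hdom' : s'.domain = gDom 0 (n + 1) m' M (clo A) (chi Bd) := by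
    ext w
    rw [hmem, hdom]
    exact mem_gDom_permIdx σ M (clo A) (chi Bd) w
  refine goodR_of_sub_mem (KZ.of_sub_of_reindex_mem_relations s (permIdx σ))
    (goodR_cleanChain s' M L e p ℓ₁ ℓ₂ (fun l => a (σ.symm l)) A Bd h1 hn ?_ hdom' (fun w hw => ?_) lam
      fun l c hc => ha _ c hc)
  · obtain ⟨R, hR⟩ := hbd.exists_norm_le
    rw [isBounded_iff_forall_norm_le]
    refine ⟨R, fun w hw => ?_⟩
    have h1 := hR _ ((hmem w).1 hw)
    refine (pi_norm_le_iff_of_nonneg ((norm_nonneg _).trans h1)).2 fun i => ?_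
    have h2 := norm_le_pi_norm (fun i => w (permIdx σ i)) ((permIdx σ).symm i)
    simp only [Equiv.apply_symm_apply] at h2
    exact h2.trans h1
  · rw [hs', KZ.IntegralRep.reindex_integrand]
    show s.integrand (fun i => w (permIdx σ i)) = _
    rw [hint ((hmem w).1 hw), glit_permIdx]

end RebaseChain

/-- Registered support goal of this file (part of `rebaseSimpleZeroMany_common`), UNCONDITIONAL
with the exceptional set WITH ROOM: chains `A < t_{σ⁻¹ 0} < ⋯ < t_{σ⁻¹ n} < B` of `n + 1` fibres
in an arbitrary order `σ` of the fibre indices, with letters of a common `y`-slope over a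
one-dimensional base (literal `GS 0 (n + 1)` datum), are congruent modulo `KZ.relations` to the
subgroup generated by `GG 0 2 (n + 1)` and `RebaseChain.mixedSetR n`
(`RebaseChain.goodR_permChain`; `σ = 1` is the clean chain). -/
theorem rebaseSimpleZeroMany_permChainRoom (n m m' n₁ n₂ : ℕ) (σ : Equiv.Perm (Fin (n + 1))) (s : KZ.IntegralRep (0 + 1 + (n + 1))) (M : Fin m' → (Fin (0 + 1) → ℚ) × ℚ) (L : Fin m → (Fin 0 → ℚ) × ℚ) (e : Fin m → ℕ) (p : MvPolynomial (Fin 0) ℚ) (ℓ₁ ℓ₂ : (Fin 0 → ℚ) × ℚ) (a : Fin (n + 1) → Option ((Fin (0 + 1) → ℚ) × ℚ)) (A Bd : (Fin (0 + 1) → ℚ) × ℚ) (h1 : n₁ = 0) (hn : n₂ = 1) (hbd : Bornology.IsBounded s.domain) (hdom : s.domain = SeparatePos.gDom 0 (n + 1) m' M (RebaseChain.plo σ A) (RebaseChain.phi σ Bd)) (hint : EqOn s.integrand (RebasePos.glit 0 (n + 1) p L e ℓ₁ ℓ₂ n₁ n₂ a) s.domain) (lam : ℚ) (ha : ∀ l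 c, a l = some c → c.1 (Fin.last 0) = lam) : ∃ c ∈ AddSubgroup.closure (SeparatePos.GGset 0 2 (n + 1) ∪ RebaseChain.mixedSetR n), KZ.of s - c ∈ KZ.relations :=
  RebaseChain.goodR_permChain σ s M L e p ℓ₁ ℓ₂ a A Bd h1 hn hbd hdom hint lam ha

end Summit.KontsevichZagierPeriods.ArrangementNormalForm.JanusBands
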